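import Summits.HubbardSuperconductivity.HubbardSuperconductivity.Theorems.AnisotropyChordTransferFibre3KT1Targets
import Summits.HubbardSuperconductivity.HubbardSuperconductivity.Theorems.AnisotropyChordTransferFibre3KernelWindow
import Summits.HubbardSuperconductivity.HubbardSuperconductivity.Theorems.AnisotropyChordTransferFibre3RateLemma

/-!
# Route `AnisotropyChord` / H0 rotor rung: PORT PartN41-A — family A for the LEVEL-2 certificate of piece A (`∀ L ≥ 128`): the solution-manifold dictionary, the cell domain, the window values

Verbatim port (modulo this header, the port comment and lint options) of the theory seat's statement file
`hubbard-h0-rotor-theory-1/cycle22/lean/PartN41A.lean` (sha16 `c1c48673ef9ec346`, «FINAL» 2026-08-30T03:45Z; theory seat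
`hubbard-h0-rotor-theory-1` g22, memo ROTOR-THEORY-22 §337, LEVEL2-SPEC §3 row A).  Statements only (`def … : Prop` targets);
their CONTENT is already proved in `…Fibre3ManifoldA` (p1 g26, p759249: `ManifoldA.manifold_dictionary`, `delta_from_cell`,
`manifold_equation`, `axis_window_closed`, `nu_ceiling`, `second_shell_window`) — the `_holds` one-liners follow in a separate file.
Prover seat `hubbard-h0-rotor-p1` g26 (route lead); helper for stmt-HubbardSuperconductivity-23918 (`--supports`, helper class).
WHAT THIS IS NOT: nothing here proves superconductivity in the Hubbard model; statement layer of ONE conditional reduction (piece A).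

Theory seat's own summary of the file:

# PartN41-A — family A for the LEVEL-2 certificate of piece A (`∀ L ≥ 128`): the solution-manifold dictionary, the cell
domain, and the window values in closed form (theory-1 g22, memo 22 §337; LEVEL2-SPEC §3 row A)

STATEMENT FILE.  Finding (memo 22 §333(i), §337): on the solution manifold every scalar of the KT rows is a rational function
of the CELL VARIABLES `(θ = 2π/L, ν = λ₂/θ², a := Δ f_nn)`:
`η_eff = π²ν`, `f_nn = a + η_eff`, `Δ = a/(a + η_eff)`, `Δ f_nn² = a(a + η_eff)`, `c_s = 4η_eff(V + a)/V`, `d = a²`,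
`q = a² + 2aη_eff`, and the ONLY place the capacity `G̃_λ(0) = S₁/V ~ ln L` enters is through the products
`c_s·G̃_λ(0) = 1 − a + a/V` (landed: `cS_mul_Gres_zero`) and `λ₂·G̃_λ(0) = (1 − a + a/V)/(V + a)` — both CLOSED in `(a, V)`.
Hence the `N₁` row (PartN41-B) and the window values (`a_λ(1,0)`, below) need NO logarithmic family-A bracket at all; family A
is needed only to LOCATE the manifold inside the `(θ, ν, a)` box, i.e. for the DOMAIN of the cell decomposition
(`NuCeiling`, `ManifoldBand`: from p1's LEMMA A0 `CapacityConst.capacity_KT_bounds`, landed), and for the second-shell window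
values `a_λ(1,1)`, `a_λ(2,0)` entering the contact corrections of the KT-2b row (PartN41-C), which p1 has landed to `O(1/L²)`
(`…ZSquareWindow`, `…WindowRate`, `CapacityConst.lamPart_KT_le`).
Nothing here is specific to `L ≥ 128` except the constants of `NuCeiling`/`ManifoldBand`.
-/

-- Port of theory seat `hubbard-h0-rotor-theory-1` cycle22/lean/PartN41A.lean (sha16 c1c48673ef9ec346) verbatim modulo this header
-- and lint options; prover seat `hubbard-h0-rotor-p1` g26, `--supports stmt-HubbardSuperconductivity-23918`.


set_option linter.dupNamespace false
set_option autoImplicit false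

noncomputable section

open scoped BigOperators

namespace Summit.HubbardSuperconductivity.HubbardSuperconductivity.Theorems.AnisotropyChord.Transfer.Fibre3

variable (L : ℕ) [NeZero L]

/-! ## §1 The dictionary (all from `etaEff_eq`, `cS` (def), `cS_mul_Gres_zero`, `ground_profile_aKer`, `kernelAxisValue_holds`) -/

/-- ★ MANIFOLD DICTIONARY: for the ground profile (`L ≥ 5`, `0 ≤ Δ < 1`), with `a := Δ f(x̂)`, `η := η_eff`, `V := L²`:
(i) `f(x̂) = a + η`; (ii) `c_s = 4η(V + a)/V`; (iii) `Δ f(x̂)² = a(a + η)`; (iv) `Δ f(x̂)²(Δ + 2(1−Δ)) = a² + 2aη`;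
(v) `c_s G̃(0) = 1 − a + a/V`; (vi) `λ₂ G̃(0) = (1 − a + a/V)/(V + a)`; (vii) `η = π²ν`, `ν := λ₂/θ²`. -/
def ManifoldDictionary (Δ : ℝ) : Prop :=
  ∀ lam2 : ℝ, ∀ f : Tor L → ℝ, 5 ≤ L → 0 ≤ Δ → Δ < 1 → IsGroundTwoMagnon L Δ lam2 f →
    let a : ℝ := Δ * f (K1 L)
    let η : ℝ := etaEff L lam2
    let V : ℝ := (L : ℝ) ^ 2
    f (K1 L) = a + η ∧
    cS L Δ lam2 f = 4 * η * (V + a) / V ∧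
    Δ * f (K1 L) ^ 2 = a * (a + η) ∧
    Δ * f (K1 L) ^ 2 * (Δ + 2 * (1 - Δ)) = a ^ 2 + 2 * a * η ∧
    cS L Δ lam2 f * Gres L lam2 0 = 1 - a + a / V ∧
    lam2 * Gres L lam2 0 = (1 - a + a / V) / (V + a) ∧
    η = Real.pi ^ 2 * (lam2 / (2 * Real.pi / L) ^ 2)

/-- `Δ` from the cell variables: `Δ = a/(a + η_eff)` (so a `Δ`-statement for all `0 < Δ < 1` is a statement on the cells
`{(ν, a)}`; `Δ → 0 ⟺ a → 0`, `Δ → 1 ⟺ ν → 0`). -/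
def DeltaFromCell (Δ : ℝ) : Prop :=
  ∀ lam2 : ℝ, ∀ f : Tor L → ℝ, 5 ≤ L → 0 ≤ Δ → Δ < 1 → IsGroundTwoMagnon L Δ lam2 f →
    Δ = Δ * f (K1 L) / (Δ * f (K1 L) + etaEff L lam2)

/-- ★ PROFILE IN CLOSED FORM ON THE WINDOW: `s(r) := 1 − f(r) = 1 − a − c_s a_λ(r)` (`r ≠ 0`, `ground_profile_aKer`) and the
nearest-neighbour window value is closed in `(a, V)`:
`a_λ(±x̂) = a_λ(±ŷ) = (1 − 1/V + (1 − a + a/V)/(V + a))/4` (`KernelAxisValue` + (vi)); consistency `a + c_s a_λ(x̂) = a + η`. -/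
def AxisWindowClosed (Δ : ℝ) : Prop :=
  ∀ lam2 : ℝ, ∀ f : Tor L → ℝ, 5 ≤ L → 0 ≤ Δ → Δ < 1 → IsGroundTwoMagnon L Δ lam2 f →
    let a : ℝ := Δ * f (K1 L)
    let V : ℝ := (L : ℝ) ^ 2
    (∀ e ∈ nnList L, aKer L lam2 e = (1 - 1 / V + (1 - a + a / V) / (V + a)) / 4) ∧
    (∀ r : Tor L, r ≠ 0 → 1 - f r = 1 - a - cS L Δ lam2 f * aKer L lam2 r)

/-- SECOND-SHELL WINDOW VALUES (needed only by the contact corrections of the KT-2b row): `a_λ(r) = a_0(r) + δ_λ(r)` with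
`a_0(r) = aZ2 r + O(1/L²)` (p1: `…ZSquareWindow`, `…WindowRate`; `aZ2(1,1) = 1/π`, `aZ2(2,0) = 1 − 2/π`) and
`0 ≤ δ_λ(r) ≤ ν|r|²(7.76 ln L + 3.3)/L²` (`CapacityConst.lamPart_KT_le`, `L ≥ 64`, `ν ≤ .07`); recorded here as the enclosure
the cell evaluator uses at `L ≥ 128`, `ν ≤ 0.0513` (`ln L/L² ≤ ln 128/128²`): `|a_λ(r) − aZ2 r| ≤ wA(r)` with an explicit
`wA`.  TARGET (constants to be fixed by the prover from the landed rate constants `C_r`): -/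
def SecondShellWindow : Prop :=
  ∀ (L : ℕ) [NeZero L], 128 ≤ L → ∀ ν : ℝ, 0 ≤ ν → ν ≤ 0.0513 →
    let lam2 : ℝ := ν * (2 * Real.pi / L) ^ 2
    |aKer L lam2 (((1 : ℤ) : ZMod L), ((1 : ℤ) : ZMod L)) - 1 / Real.pi| ≤ 0.001 ∧
    |aKer L lam2 (((2 : ℤ) : ZMod L), ((0 : ℤ) : ZMod L)) - (1 - 2 / Real.pi)| ≤ 0.001

/-! ## §2 The DOMAIN of the cell decomposition at `L ≥ 128` -/

/-- ★ ν-CEILING: a ground profile with `0 < Δ < 1` at `L ≥ 128` has `ν = λ₂/θ² < 0.031`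
(`c_s G̃(0) = 1 − a + a/V < 1` for `a > 0`, `c_s = 4π²ν(1 + a/V) ≥ 4π²ν`, and `G̃_λ(0) ≥ G̃_0(0) ≥ ln 128/2π + 0.0456 = 0.8178`
by `capacity_const_bounds` + monotonicity in `λ` (`excess_bracket`); `1/(4π²·0.8178) = 0.03097`).  In particular the KT regime
`ν ≤ 0.0513` of `gm3_allL_window` is automatic there, and the cells live in `ν ∈ (0, 0.031]`. -/
def NuCeiling : Prop :=
  ∀ (L : ℕ) [NeZero L], 128 ≤ L → ∀ Δ lam2 : ℝ, ∀ f : Tor L → ℝ, 0 < Δ → Δ < 1 → IsGroundTwoMagnon L Δ lam2 f →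
    lam2 < 0.031 * (2 * Real.pi / L) ^ 2

/-- ★ MANIFOLD BAND: where the manifold sits in the `(θ, ν, a)` box (`L ≥ 128`, `0 ≤ Δ < 1`): with `η = π²ν`,
`gL⁻ := ln L/2π + 0.0456 + 0.1266ν ≤ G̃_λ(0) ≤ gL⁺ := ln L/2π + 0.0510 + 0.234ν` (`capacity_KT_bounds`) and
`4η G̃_λ(0)(V + a) = V(1 − a) + a` (dictionary (ii),(v)):
`1 − 4η·gL⁺·(1 + 1/V) ≤ a`, `a(V−1) ≤ V(1 − 4η·gL⁻)`, and `0 ≤ a`, `a(1 − 1/V) < 1`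
(p1 g26 typing note 03:39Z: `a < 1` is false as `Δ → 1⁻` since `a → V/(V−1)`; hence the `(1 − 1/V)` forms). -/
def ManifoldBand : Prop :=
  ∀ (L : ℕ) [NeZero L], 128 ≤ L → ∀ Δ lam2 : ℝ, ∀ f : Tor L → ℝ, 0 ≤ Δ → Δ < 1 → IsGroundTwoMagnon L Δ lam2 f →
    let a : ℝ := Δ * f (K1 L)
    let η : ℝ := etaEff L lam2
    let ν : ℝ := lam2 / (2 * Real.pi / L) ^ 2
    let V : ℝ := (L : ℝ) ^ 2
    0 ≤ a ∧ a * (1 - 1 / V) < 1 ∧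
    1 - 4 * η * (Real.log L / (2 * Real.pi) + 0.0510 + 0.234 * ν) * (1 + 1 / V) ≤ a ∧
    a * (V - 1) ≤ V * (1 - 4 * η * (Real.log L / (2 * Real.pi) + 0.0456 + 0.1266 * ν))

/-- the exact manifold equation in cell variables (dictionary (ii)+(v)), the form the cell evaluator may use as a CONSTRAINT
(never to evaluate `G̃(0)` itself): `4 η_eff G̃_λ(0) (V + a) = V(1 − a) + a`. -/
def ManifoldEquation (Δ : ℝ) : Prop :=
  ∀ lam2 : ℝ, ∀ f : Tor L → ℝ, 5 ≤ L → 0 ≤ Δ → Δ < 1 → IsGroundTwoMagnon L Δ lam2 f →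
    4 * etaEff L lam2 * Gres L lam2 0 * ((L : ℝ) ^ 2 + Δ * f (K1 L)) = (L : ℝ) ^ 2 * (1 - Δ * f (K1 L)) + Δ * f (K1 L)

end Summit.HubbardSuperconductivity.HubbardSuperconductivity.Theorems.AnisotropyChord.Transfer.Fibre3

end
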